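import Literature.AnabelianGeometry.EtaleTheta.Discharge.Sec4NonVacuity
import HarnessLib

/-!
# [EtTh] Definition 4.1 (iv)(e) "arise from a base-Frobenius pair" (`TemperedFrobenioid.ArisesFromBaseFrobeniusPair`):
# structural consequences and the (negative) universal closure — a schema certificate

S. Mochizuki, *The étale theta function and its Frobenioid-theoretic manifestations*, Publ. RIMS **45**
(2009), Def. 4.1 (iv), printed p. 313 (PDF p. 87) [cite: MochizukiEtTh2009, Def 4.1 p.313 (PDF p.87)]:
"(e) `G`, `α'`, `α''` arise from a base-Frobenius pair of `C` [cf. Theorem 3.7, (i); [FrdI], Proposition 5.6]".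

PROOF-ONLY companion of `BiKummerOfModelCanonical.lean` (statements, seat abc-iut-L2-t9), abc-iut cell, block F
(fact-proving wave), seat abc-iut-f-108, FACT-LIST row **F-2482** `TemperedFrobenioid.ArisesFromBaseFrobeniusPair`.
The declaration is VOCABULARY — the predicate filling slot (e) of Def. 4.1 (iv) (`BaseFrobeniusTypeData.cond_e`
through `BiKummerSetting.mkOfModelCanonical`), not a claim of the paper.  Accordingly this file records:

* the STRUCTURAL CONSEQUENCES that hold whenever the predicate holds (instance forms consumed downstream):
  `α''` is a base-identity endomorphism of Frobenius type — in particular an isometry — of the Frobenius degree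
  named by the Frobenius-section ([FrdI] Def. 2.7 (ii)); `α'` and every element of `G` are pull-back morphisms
  (`P ⊆ C^{pl-bk}`, [FrdI] Def. 2.7 (i)); domain and codomain are Frobenius-trivial objects of `P`; the predicate is
  antitone in `G`;
* the universal closure is FALSE: an endomorphism with NON-ZERO zero divisor is never `F`-distinguished, so it never
  "arises from a base-Frobenius pair" — general form `not_arisesFromBaseFrobeniusPair_of_div_ne_one` over ANY tempered
  Frobenioid, closed witness over abc-iut-L6-t12's perfect toy `Toy.temperedFrobenioidQ` (`Discharge/Sec4NonVacuity.lean`: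
  one-object base, `Φ = ℚ_{≥0}`, `B = ℤ`), where the endomorphism `(1, id, 𝔭, 1·𝔭)` of `A_⊙ = (∗, 0)` has divisor `𝔭 ≠ 0`
  (`Toy.exists_not_arisesFromBaseFrobeniusPair`, `not_forall_arisesFromBaseFrobeniusPair`).

So the row is a SCHEMA: consumable only as the hypothesis slot (e) it was typed for, at the instances where it is
SUPPLIED (e.g. abc-iut-L6-t12's `Toy.arisesFromBaseFrobeniusPair_one`), never as a free-standing fact.  This refutes
nothing in print; no statement of the paper is restated or strengthened; no new definition, no instance, no `sorry`.
HONEST FRAMING: typed ≠ proved; nothing here bears on, or takes a side on, [IUTchIII] Cor. 3.12.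
-/

noncomputable section

namespace Literature.AnabelianGeometry.EtaleTheta

open CategoryTheory Opposite Literature.AlgebraicGeometry.Frobenioids

universe u₀ v₀ u v w

namespace TemperedFrobenioid

variable {D₀ : Type u₀} [Category.{v₀} D₀] {V : FrdIMonoidStub.{w}}
  {T : RealifiedDivisorMonoids (D₀ := D₀) V} {D : Type u} [Category.{v} D]
  {VD : FrdICatStub.{u, v, w} D} {C : TemperedFrobenioid T D VD}

/-! ### Structural consequences of "arise from a base-Frobenius pair" -/

namespace ArisesFromBaseFrobeniusPair

variable {A B : C.category} {G : Subgroup (Aut A)} {α₂ : A ⟶ A} {α₁ : A ⟶ B}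

/-- If `G, α', α''` arise from the base-Frobenius pair `(P, F)`, then `α'' = F(n)_A` is a **base-identity**
endomorphism ([FrdI] Def. 2.7 (ii)(b)). [cite: MochizukiEtTh2009, Def 4.1 p.313 (PDF p.87)] -/
theorem isBaseIdentity (h : C.ArisesFromBaseFrobeniusPair G α₂ α₁) :
    PreFrobenioid.IsBaseIdentity C.toElem α₂ := by
  obtain ⟨P, Fr, hPF, -, -, hA, n, hn⟩ := h
  rw [← hn]
  exact hPF.isFrobeniusSection.isBaseIdentity n ⟨A, hA⟩

/-- If `G, α', α''` arise from the base-Frobenius pair `(P, F)`, then `α''` is **of Frobenius type**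
([FrdI] Def. 2.7 (ii)(b)). [cite: MochizukiEtTh2009, Def 4.1 p.313 (PDF p.87)] -/
theorem isFrobeniusType (h : C.ArisesFromBaseFrobeniusPair G α₂ α₁) :
    PreFrobenioid.IsFrobeniusType C.toElem α₂ := by
  obtain ⟨P, Fr, hPF, -, -, hA, n, hn⟩ := h
  rw [← hn]
  exact hPF.isFrobeniusSection.isFrobeniusType n ⟨A, hA⟩

/-- In particular `α''` is an **isometry**: `Div(α'') = 0`. [cite: MochizukiEtTh2009, Def 4.1 p.313 (PDF p.87)] -/
theorem isIsometry (h : C.ArisesFromBaseFrobeniusPair G α₂ α₁) :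
    PreFrobenioid.IsIsometry C.toElem α₂ :=
  h.isFrobeniusType.1.2

/-- … i.e. the zero divisor of `α''` in the model Frobenioid is trivial. [cite: MochizukiEtTh2009, Def 4.1 p.313 (PDF p.87)] -/
theorem div_eq_one (h : C.ArisesFromBaseFrobeniusPair G α₂ α₁) : ModelFrobenioid.div α₂ = 1 :=
  h.isIsometry

/-- The Frobenius degree of `α''` is the index `n` with `α'' = F(n)_A` ([FrdI] Def. 2.7 (ii)(a)).
[cite: MochizukiEtTh2009, Def 4.1 p.313 (PDF p.87)] -/
theorem exists_degFr_eq (h : C.ArisesFromBaseFrobeniusPair G α₂ α₁) :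
    ∃ (P : Presection C.category) (Fr : ℕ+ →* End P.ι) (hA : P.obj A) (n : ℕ+),
      PreFrobenioid.IsBaseFrobeniusPair C.toElem P Fr ∧ (Fr n).app ⟨A, hA⟩ = α₂ ∧
        PreFrobenioid.degFr C.toElem α₂ = n := by
  obtain ⟨P, Fr, hPF, -, -, hA, n, hn⟩ := h
  refine ⟨P, Fr, hA, n, hPF, hn, ?_⟩
  rw [← hn]
  exact hPF.isFrobeniusSection.degFr_eq n ⟨A, hA⟩

/-- If `G, α', α''` arise from the base-Frobenius pair `(P, F)`, then `α'` is a **pull-back morphism**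
(`P ⊆ C^{pl-bk}`, [FrdI] Def. 2.7 (i)) — cf. Def. 4.1 (iv)(d). [cite: MochizukiEtTh2009, Def 4.1 p.313 (PDF p.87)] -/
theorem isPullbackMorphism (h : C.ArisesFromBaseFrobeniusPair G α₂ α₁) :
    PreFrobenioid.IsPullbackMorphism C.toElem α₁ := by
  obtain ⟨P, Fr, hPF, -, h₁, -⟩ := h
  exact hPF.isBaseSection.hom_pullback α₁ h₁

/-- … and so is (the underlying morphism of) every element of `G` (`G ⊆ Aut_P(A) ⊆ C^{pl-bk}`).
[cite: MochizukiEtTh2009, Def 4.1 p.313 (PDF p.87)] -/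
theorem isPullbackMorphism_of_mem (h : C.ArisesFromBaseFrobeniusPair G α₂ α₁) {γ : Aut A} (hγ : γ ∈ G) :
    PreFrobenioid.IsPullbackMorphism C.toElem γ.hom := by
  obtain ⟨P, Fr, hPF, hG, -, -⟩ := h
  exact hPF.isBaseSection.hom_pullback γ.hom (hG γ hγ)

/-- The domain `A` is a **Frobenius-trivial** object (of `P`) ([FrdI] Def. 2.7 (i)(b); [FrdI] Prop. 5.6 "`A ∈ Ob(P)`
a Frobenius-trivial object") — cf. Def. 4.1 (iv)(a). [cite: MochizukiEtTh2009, Def 4.1 p.313 (PDF p.87)] -/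
theorem isFrobeniusTrivial_fst (h : C.ArisesFromBaseFrobeniusPair G α₂ α₁) :
    PreFrobenioid.IsFrobeniusTrivial C.toElem A := by
  obtain ⟨P, Fr, hPF, hPA, -⟩ := h.exists_obj
  exact hPF.isBaseSection.isFrobeniusTrivial A hPA

/-- The codomain `B` of `α'` is a **Frobenius-trivial** object (of `P`). [cite: MochizukiEtTh2009, Def 4.1 p.313 (PDF p.87)] -/
theorem isFrobeniusTrivial_snd (h : C.ArisesFromBaseFrobeniusPair G α₂ α₁) :
    PreFrobenioid.IsFrobeniusTrivial C.toElem B := by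
  obtain ⟨P, Fr, hPF, -, hPB⟩ := h.exists_obj
  exact hPF.isBaseSection.isFrobeniusTrivial B hPB

/-- The predicate is **antitone in `G`**: a smaller subgroup arises from the same base-Frobenius pair.
[cite: MochizukiEtTh2009, Def 4.1 p.313 (PDF p.87)] -/
theorem anti (h : C.ArisesFromBaseFrobeniusPair G α₂ α₁) {G' : Subgroup (Aut A)} (hG' : G' ≤ G) :
    C.ArisesFromBaseFrobeniusPair G' α₂ α₁ := by
  obtain ⟨P, Fr, hPF, hG, h₁, h₂⟩ := h
  exact ⟨P, Fr, hPF, fun γ hγ => hG γ (hG' hγ), h₁, h₂⟩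

/-- In particular the trivial subgroup arises from the same pair. [cite: MochizukiEtTh2009, Def 4.1 p.313 (PDF p.87)] -/
theorem bot (h : C.ArisesFromBaseFrobeniusPair G α₂ α₁) : C.ArisesFromBaseFrobeniusPair ⊥ α₂ α₁ :=
  h.anti bot_le

end ArisesFromBaseFrobeniusPair

/-- For the trivial subgroup the `G`-clause is vacuous: `1, α', α''` arise from a base-Frobenius pair iff some
base-Frobenius pair `(P, F)` has `α'` `P`-distinguished and `α''` `F`-distinguished.
[cite: MochizukiEtTh2009, Def 4.1 p.313 (PDF p.87)] -/
theorem arisesFromBaseFrobeniusPair_bot_iff {A B : C.category} (α₂ : A ⟶ A) (α₁ : A ⟶ B) :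
    C.ArisesFromBaseFrobeniusPair ⊥ α₂ α₁ ↔
      ∃ (P : Presection C.category) (Fr : ℕ+ →* End P.ι), PreFrobenioid.IsBaseFrobeniusPair C.toElem P Fr ∧
        PreFrobenioid.IsDistinguished P α₁ ∧ PreFrobenioid.IsFDistinguished P Fr α₂ := by
  constructor
  · rintro ⟨P, Fr, hPF, -, h₁, h₂⟩
    exact ⟨P, Fr, hPF, h₁, h₂⟩
  · rintro ⟨P, Fr, hPF, h₁, h₂⟩
    refine ⟨P, Fr, hPF, fun γ hγ => ?_, h₁, h₂⟩
    rw [Subgroup.mem_bot] at hγ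
    subst hγ
    exact P.hom_id (P.obj_of_hom α₁ h₁).1

/-! ### The universal closure is false (the row is a schema, not a fact) -/

/-- **No endomorphism with non-zero zero divisor arises from a base-Frobenius pair** (as the `α''`-component):
`F`-distinguished endomorphisms are of Frobenius type, hence isometries. Holds over every tempered Frobenioid.
[cite: MochizukiEtTh2009, Def 4.1 p.313 (PDF p.87)] -/
theorem not_arisesFromBaseFrobeniusPair_of_div_ne_one {A B : C.category} (G : Subgroup (Aut A)) {α₂ : A ⟶ A}
    (α₁ : A ⟶ B) (hα₂ : ModelFrobenioid.div α₂ ≠ 1) : ¬ C.ArisesFromBaseFrobeniusPair G α₂ α₁ :=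
  fun h => hα₂ h.div_eq_one

/-- Hence, over ANY tempered Frobenioid possessing an endomorphism with non-zero zero divisor, the universal
closure of Def. 4.1 (iv)(e) over `(A, B, G, α'', α')` fails. [cite: MochizukiEtTh2009, Def 4.1 p.313 (PDF p.87)] -/
theorem not_forall_arisesFromBaseFrobeniusPair_of_exists (C : TemperedFrobenioid T D VD)
    (hC : ∃ (A : C.category) (φ : A ⟶ A), ModelFrobenioid.div φ ≠ 1) :
    ¬ ∀ (A B : C.category) (G : Subgroup (Aut A)) (α₂ : A ⟶ A) (α₁ : A ⟶ B),
        C.ArisesFromBaseFrobeniusPair G α₂ α₁ := by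
  obtain ⟨A, φ, hφ⟩ := hC
  exact fun h => not_arisesFromBaseFrobeniusPair_of_div_ne_one ⊥ (𝟙 A) hφ (h A A ⊥ φ (𝟙 A))

end TemperedFrobenioid

/-! ### Closed witness over the perfect toy tempered Frobenioid -/

namespace Toy

/-- **Closed witness**: over the perfect toy tempered Frobenioid (`Discharge/Sec4NonVacuity.lean`: one-object base,
`Φ = ℚ_{≥0}`, `B = ℤ ×_{(ℚ_{≥0})^gp} (ℚ_{≥0})^gp`), the endomorphism `(1, id, 𝔭, 1·𝔭)` of `A_⊙ = (∗, 0)` — Frobenius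
degree `1`, base the identity, zero divisor the generator `𝔭 = 1 ∈ ℚ_{≥0}`, unit the rational function `(1, 𝔭)`,
relation `0 + 𝔭 = 0 + Div_B(1·𝔭)` — has `Div = 𝔭 ≠ 0`, so `G = 1`, `α'' :=` it, `α' = id` do NOT arise from a
base-Frobenius pair. [cite: MochizukiEtTh2009, Def 4.1 p.313 (PDF p.87)] -/
theorem exists_not_arisesFromBaseFrobeniusPair_Aodot :
    ∃ α₂ : Aodot ⟶ Aodot, ModelFrobenioid.div α₂ ≠ 1 ∧
      ∀ (B : temperedFrobenioidQ.category) (G : Subgroup (Aut Aodot)) (α₁ : Aodot ⟶ B),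
        ¬ temperedFrobenioidQ.ArisesFromBaseFrobeniusPair G α₂ α₁ := by
  -- the generator `𝔭` of `Φ(∗) = ℚ_{≥0}` (multiplicative notation)
  let p : temperedFrobenioidQ.Φ.carrier (op (ModelFrobenioid.base Aodot)) :=
    ⟨Multiplicative.ofAdd (1 : ℚ≥0), trivial⟩
  have hp : p ≠ 1 := fun h => by
    have h' : (Multiplicative.ofAdd (1 : ℚ≥0) : Multiplicative ℚ≥0) = Multiplicative.ofAdd 0 :=
      congrArg Subtype.val h
    exact one_ne_zero (Multiplicative.ofAdd.injective h')
  -- the rational function `1·𝔭 = (1, 𝔭) ∈ B(∗)`: both components map to `𝔭 ∈ (Φ^{ℝ-log})^gp(∗)`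
  have hu : divHomQ (Multiplicative.ofAdd (1 : ℤ)) =
      gpMap (temperedFrobenioidQ.Φ.carrier (op (ModelFrobenioid.base Aodot))).subtype
        (Algebra.GrothendieckGroup.of p) := by
    rw [divHomQ_ofAdd_one, gpMap_of]
    rfl
  let u : temperedFrobenioidQ.ratFn (op (ModelFrobenioid.base Aodot)) :=
    ⟨(Multiplicative.ofAdd (1 : ℤ), Algebra.GrothendieckGroup.of p), hu⟩
  refine ⟨ModelFrobenioid.mkHom Aodot Aodot 1 (𝟙 _) p u ?_, hp, fun B G α₁ =>
    TemperedFrobenioid.not_arisesFromBaseFrobeniusPair_of_div_ne_one G α₁ hp⟩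
  rw [PNat.one_coe, pow_one, pullGp_id]
  rfl

/-- Hence a closed counter-instance to the universal closure over the perfect toy.
[cite: MochizukiEtTh2009, Def 4.1 p.313 (PDF p.87)] -/
theorem exists_not_arisesFromBaseFrobeniusPair :
    ∃ (A B : temperedFrobenioidQ.category) (G : Subgroup (Aut A)) (α₂ : A ⟶ A) (α₁ : A ⟶ B),
      ¬ temperedFrobenioidQ.ArisesFromBaseFrobeniusPair G α₂ α₁ := by
  obtain ⟨α₂, -, h⟩ := exists_not_arisesFromBaseFrobeniusPair_Aodot
  exact ⟨Aodot, Aodot, ⊥, α₂, 𝟙 _, h Aodot ⊥ (𝟙 _)⟩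

/-- … while (abc-iut-L6-t12, `Discharge/Sec4NonVacuity.lean`) `G = 1`, `α' = α'' = id_{A_⊙}` DO arise from the zero
section: the predicate is satisfiable and refutable at the same object with the same `G`, `α'` — a genuine schema.
[cite: MochizukiEtTh2009, Def 4.1 p.313 (PDF p.87)] -/
theorem arisesFromBaseFrobeniusPair_one_and_exists_not :
    temperedFrobenioidQ.ArisesFromBaseFrobeniusPair (A := Aodot) ⊥ (𝟙 Aodot) (𝟙 Aodot) ∧
      ∃ α₂ : Aodot ⟶ Aodot, ¬ temperedFrobenioidQ.ArisesFromBaseFrobeniusPair (B := Aodot) ⊥ α₂ (𝟙 Aodot) := by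
  obtain ⟨α₂, -, h⟩ := exists_not_arisesFromBaseFrobeniusPair_Aodot
  exact ⟨arisesFromBaseFrobeniusPair_one, α₂, h Aodot ⊥ (𝟙 _)⟩

end Toy

/-- **The universal closure of Def. 4.1 (iv)(e) is false** (FACT-LIST row F-2482 is a SCHEMA: the predicate
`TemperedFrobenioid.ArisesFromBaseFrobeniusPair` is hypothesis slot (e) of "of base-Frobenius type", to be SUPPLIED
per instance, never assumed for all data): quantified over all tempered Frobenioids (universe `0`) and all
`(A, B, G, α'', α')`, it fails at the perfect toy. [cite: MochizukiEtTh2009, Def 4.1 p.313 (PDF p.87)] -/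
theorem not_forall_arisesFromBaseFrobeniusPair :
    ¬ ∀ (D₀ : Type) [Category.{0} D₀] (V : FrdIMonoidStub.{0}) (T : RealifiedDivisorMonoids (D₀ := D₀) V)
        (D : Type) [Category.{0} D] (VD : FrdICatStub.{0, 0, 0} D) (C : TemperedFrobenioid T D VD)
        (A B : C.category) (G : Subgroup (Aut A)) (α₂ : A ⟶ A) (α₁ : A ⟶ B),
        C.ArisesFromBaseFrobeniusPair G α₂ α₁ := by
  intro h
  obtain ⟨A, B, G, α₂, α₁, hn⟩ := Toy.exists_not_arisesFromBaseFrobeniusPair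
  exact hn (h _ _ _ _ _ _ _ _ _ _ _)

end Literature.AnabelianGeometry.EtaleTheta

end
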